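import Summits.ABC.IUTFork.Cor312SlotHullJunctionM
import Summits.ABC.IUTFork.Cor312SlotHullJunctionK
import Summits.ABC.IUTFork.Cor312ThetaSlotExactM
import HarnessLib

/-!
# [IUTchIII] Corollary 3.12 — the JUNCTION of the readings (U) and (P) of `−|log(Θ)|` AT THE M-LEVEL GENUINE SHARP SETTINGS (own ideles of a
# genuine Θ-volume input): `U = P + SR(I) ± Σ_{T(I)∖C} log p` on BOTH routes, coincidence at slot-constant data, `SlotStatement ↔ (1.1) per image`,
# and the M ↔ K AGREEMENT of the reading-(P) statements

PROOF-ONLY file (D-0012; no definitions, no `Prop` facts, nothing re-typed) of the abc-iut cell (R2 S-chain team, seat abc-iut-s2-p2 gen 4,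
self-named row «U-P-JUNCTION-M», part (iii-c)). TAKES NO SIDE on [IUTchIII] Cor. 3.12, on the reading (U)/(P) of `−|log(Θ)|`, or on any author.
Everything is COMPOSED BY NAME from: part (iii-b) `Cor312SlotHullJunctionM` §3 (the junction FROM EXACTNESS, generic), part (iii-a)
`Cor312SlotHullSetLocality` (frames route = summand route for the slot quantities), abc-iut-s2-p9's (U) exactness
`negLogTheta_settingPrVolSharpM_tOfIdeleData_eq_negLogThetaNonarch` (p449545), abc-iut-C-cert-2's (P) exactness = the M-level slot READ
`negLogThetaSlot_settingPrVolSharpM_tOfIdeleData_eq_negLogThetaPerImageNonarch` (`Cor312ThetaSlotExactM`, p469199), abc-iut-w5-d244's `q`-side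
`negLogQ_settingPrVolSharpM_tqM_eq_negAbsLogQ` (p440575), abc-iut-s2-p2's input-level identity `negLogThetaNonarch_perImage_two_sided_of_slotConstantOn`
(p440845), and — for the M ↔ K agreement — abc-iut-s2-p2's `K`-line readout `slotStatement_settingPrVolSharp_pilotDataOfK_iff_cor312PerImageNonarchOf`
(p464613).

S. Mochizuki, *Inter-universal Teichmüller theory III* [Mochizuki2012]: Cor. 3.12 p. 173 l. 43 – p. 174 l. 18, proof Step (x) p. 181; [IUTchI]
Def. 3.1 (e) p. 62 (`V̲`, the carriers `K_{v̲}` of the M level); *IUT IV* Thm. 1.10 Step (v) p. 27–28. T. Dupuy, A. Hilado [DupuyHilado2025] §1 (1.1),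
§4.7, §4.9, §4.11–4.12.

* §5 (own Θ-ideles `tOfIdeleData D r`, ANY `q`-ideles, BOTH routes): **`negLogTheta_two_sided_negLogThetaSlot_settingPrVolSharpM_tOfIdeleData`** /
  `…settingMSharp…` (`−|log(Θ)|_(P) + ↑(SR − Σ_{T∖C} log p) ≤ −|log(Θ)|_(U) ≤ −|log(Θ)|_(P) + ↑(SR + Σ_{T∖C} log p)`), the frames-route READ
  `negLogThetaSlot_settingMSharp_tOfIdeleData_eq_negLogThetaPerImageNonarch` (C-cert-2's READ carried along part (iii-a)), `…_le_negLogThetaPerImage`,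
  `negLogThetaSlot_le_negLogTheta_…` with NO side condition, **`negLogThetaSlot_eq_negLogTheta_…_of_slotConstant`**,
  **`slotStatement_iff_statement_…_of_slotConstant`** / `…_of_finrank_eq_one`;
* §6 (own Θ- AND `q`-ideles — the M books' VERBATIM setting shape, abc-iut-C-cert-1 `AbcOfSlotLicenceGenuineM` p468614 / abc-iut-C-cert-3 p453767):
  **`slotStatement_settingPrVolSharpM_genuine_iff_cor312PerImageNonarchOf`** / `…settingMSharp…` (the M-line `hstPBad` body, per datum, IS Dupuy–Hilado's
  (1.1) PER IMAGE, nonarchimedean form), `GenuineM.cor312NonarchOf_of_slotStatement`, `GenuineM.cor312PerImageNonarch_add_slotResidue_of_statement`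
  (the (U) body gives (1.1) per image weakened by EXACTLY `SR(I) + Σ_{p∈T(I)} log p`);
* §7 **`slotStatement_settingMSharp_genuine_iff_slotStatement_settingPrVolSharp_pilotDataOfK`** — M ↔ K AGREEMENT IN READING (P): for every volume
  input `I` of `D`, the typed `SlotStatement` at the M-level genuine setting ⟺ the typed `SlotStatement` at the sharp `K`-setting at ANY realising
  ideles: both are `I.Cor312PerImageNonarchOf` — the (P) twin of abc-iut-s2-p7's `statement_settingMSharp_genuine_iff_statement_settingPrVolSharp_pilotDataOfK`;
  so the [hstPBad] hypotheses of the M-line and `K`-line γ certificates are, per datum, ONE proposition.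

HONEST SCOPE: identities/inequalities/equivalences between OUR typings at the genuine data; nothing asserts either statement at any datum;
typed ≠ proved; instantiated ≠ endorsed. [cite: Mochizuki2012, IUTchIII Cor. 3.12 p. 173–174, proof Step (x) p. 181; Thm. 3.11 (i) p. 154]
[cite: Mochizuki2012, IUTchI Def. 3.1 (e) p. 62] [cite: Mochizuki2012, IUTchIV Thm. 1.10 p. 23, Step (v) p. 27–28, Step (vii) p. 30]
[cite: DupuyHilado2025, §1 (1.1), §4.7, §4.9, §4.11–4.12] [claim: Mochizuki2012, status: disputed] for every quoted construction.
-/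

noncomputable section

open Set Function NumberField IsDedekindDomain

namespace Summit.ABC.IUTFork.Thm311.Real

open Cor312 Cor312Vol Cor312Prov Literature.IUT.LogThetaLattice Literature.IUT.LogVolume Literature.IUT.HodgeTheaters
  Literature.NumberTheory.NumberFields

variable {F K Fbar : Type} [Field F] [NumberField F] [Field K] [NumberField K] [Algebra F K]
  [Field Fbar] [Algebra F Fbar] [Algebra K Fbar] {E : WeierstrassCurve F} [E.IsElliptic] {l : ℕ}
  {Pb : BadPlacePredicates K} (D : InitialThetaData F K Fbar E l Pb) {logvK : PadicLogsVal K}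
  (hlog : LogvAnalyticVal logvK) (r : ThetaData.IdeleData D)
  (tq : ∀ (u : FinitePlace ℚ) (x : (thetaIndexOfInitial D).Fibre (Val.non u)),
    kOfM D (ratChar u) u (natCast_ratChar_mem u) x)
  (M : Type) [Field M] [NumberField M]
  (archPk : ∀ (j : (thetaIndexOfInitial D).Label) (vQ : (thetaIndexOfInitial D).VQ),
    Set ((logShellsOfInitialDH D logvK).Packet j vQ))
  (archSub : ∀ (j : (thetaIndexOfInitial D).Label) (v : (thetaIndexOfInitial D).V),
    Set ((logShellsOfInitialDH D logvK).Packet j ((thetaIndexOfInitial D).over v)))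
  (Ψ : ℤ → ∀ v : (thetaIndexOfInitial D).V, v ∈ (thetaIndexOfInitial D).Vbad →
    Set ((logShellsOfInitialDH D logvK).StarPacket v))
  (act : ℤ → ∀ v : (thetaIndexOfInitial D).V, v ∈ (thetaIndexOfInitial D).Vbad →
    (logShellsOfInitialDH D logvK).StarPacket v → Module.End ℚ ((logShellsOfInitialDH D logvK).StarPacket v))
  (Mmod : ℤ → ∀ j : (thetaIndexOfInitial D).LabelStar, Set ((logShellsOfInitialDH D logvK).GlobalPacket j.1))
  (region : ℤ → ∀ j : (thetaIndexOfInitial D).LabelStar, FinDivisor M → ∀ vQ : (thetaIndexOfInitial D).VQ,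
    Set ((logShellsOfInitialDH D logvK).Packet j.1 vQ))
  (n : ℤ) {HT : Type} {LogLink : HT → HT → Type} {IsFull : ∀ {s t : HT}, LogLink s t → Prop}
  (lat : LGPGaussianLogThetaLattice LogLink IsFull)
  {Frd : Type} {IsoF : Frd → Frd → Type} {Ob : Frd → Type} {realify : Frd → Frd} {Strip : Type}
  {IsoS : Strip → Strip → Type}
  {Mv : ∀ v : (thetaIndexOfInitial D).V, v ∈ (thetaIndexOfInitial D).Vbad → Type} [∀ v h, Monoid (Mv v h)]
  (sig : GlobalLGPFrobenioidSignature (thetaIndexOfInitial D).lstar (thetaIndexOfInitial D).V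
    (· ∈ (thetaIndexOfInitial D).Vbad) Frd IsoF Ob realify Strip IsoS Mv)
  (split : SplittingMonoids Mv) {ObΔ : Type}
  {N : ∀ v : (thetaIndexOfInitial D).V, v ∈ (thetaIndexOfInitial D).Vbad → Type} [∀ v h, Monoid (N v h)]
  (qData : QPilotData ObΔ N)
  (htq0 : ∀ u x, tq u x ≠ 0) (Sq : Finset (FinitePlace ℚ))
  (htq1 : ∀ (u : FinitePlace ℚ) (x : (thetaIndexOfInitial D).Fibre (Val.non u)), u ∉ Sq → ‖tq u x‖ = 1)

/-! ## §5. Own Θ-ideles, any `q`-ideles, both routes: `U = P + SR(I) ± Σ_{T(I)∖C} log p`; coincidence at slot-constant data -/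

/-- **The frames-route READ**: at abc-iut-w5-d166's `settingMSharp` of the datum's own Θ-ideles, `−|log(Θ)|_(P) = ↑(volumeInputOf D r).negLogThetaPerImageNonarch`
— abc-iut-C-cert-2's summand-route READ (p469199) carried along part (iii-a)'s `negLogThetaSlot_settingMSharp_eq_settingPrVolSharpM`.
[cite: Mochizuki2012, IUTchIII Cor. 3.12 proof Step (x) p. 181] [cite: DupuyHilado2025, §4.12] [claim: Mochizuki2012, status: disputed] -/
theorem negLogThetaSlot_settingMSharp_tOfIdeleData_eq_negLogThetaPerImageNonarch :
    (settingMSharp D hlog M archPk archSub Ψ act Mmod region n lat sig split qData (tOfIdeleData D r) tq htq0 Sq htq1).negLogThetaSlot =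
      (((ThetaData.volumeInputOf D r).negLogThetaPerImageNonarch : ℝ) : WithTop ℝ) := by
  rw [negLogThetaSlot_settingMSharp_eq_settingPrVolSharpM]
  exact negLogThetaSlot_settingPrVolSharpM_tOfIdeleData_eq_negLogThetaPerImageNonarch D hlog r tq M archPk archSub Ψ act Mmod region n lat
    sig split qData htq0 Sq htq1

/-- `ThetaSlotFinite` at the frames-route setting of the datum's own Θ-ideles. [claim: Mochizuki2012, status: disputed] -/
theorem thetaSlotFinite_settingMSharp_tOfIdeleData :
    (settingMSharp D hlog M archPk archSub Ψ act Mmod region n lat sig split qData (tOfIdeleData D r) tq htq0 Sq htq1).ThetaSlotFinite :=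
  Cor312.Setting.thetaSlotFinite_of_exact _ _
    (negLogThetaSlot_settingMSharp_tOfIdeleData_eq_negLogThetaPerImageNonarch D hlog r tq M archPk archSub Ψ act Mmod region n lat sig split
      qData htq0 Sq htq1)

/-- **The frames-route READ-P bound**: `−|log(Θ)|_(P)(settingMSharp … own Θ-ideles …) ≤ ↑(volumeInputOf D r).negLogThetaPerImage` (+ the archimedean
summand `((l+5)/4)·log π`). [cite: Mochizuki2012, IUTchIV Thm. 1.10 Step (vii) p. 30] [claim: Mochizuki2012, status: disputed] -/
theorem negLogThetaSlot_settingMSharp_tOfIdeleData_le_negLogThetaPerImage :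
    (settingMSharp D hlog M archPk archSub Ψ act Mmod region n lat sig split qData (tOfIdeleData D r) tq htq0 Sq htq1).negLogThetaSlot ≤
      (((ThetaData.volumeInputOf D r).negLogThetaPerImage : ℝ) : WithTop ℝ) := by
  rw [negLogThetaSlot_settingMSharp_eq_settingPrVolSharpM]
  exact negLogThetaSlot_settingPrVolSharpM_tOfIdeleData_le_negLogThetaPerImage D hlog r tq M archPk archSub Ψ act Mmod region n lat sig
    split qData htq0 Sq htq1

/-- **`−|log(Θ)|_(P) ≤ −|log(Θ)|_(U)` at the summand-route setting of the datum's own Θ-ideles, NO side condition.**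
[cite: Mochizuki2012, IUTchIII Cor. 3.12 p. 173–174, proof Step (x) p. 181; Prop. 3.9 (ii) p. 116] [claim: Mochizuki2012, status: disputed] -/
theorem negLogThetaSlot_le_negLogTheta_settingPrVolSharpM_tOfIdeleData :
    (settingPrVolSharpM D hlog (tOfIdeleData D r) tq M archPk archSub Ψ act Mmod region n lat sig split qData htq0 Sq htq1).negLogThetaSlot ≤
      (settingPrVolSharpM D hlog (tOfIdeleData D r) tq M archPk archSub Ψ act Mmod region n lat sig split qData htq0 Sq htq1).negLogTheta := by
  rw [← negLogThetaSlot_settingMSharp_eq_settingPrVolSharpM, ← negLogTheta_settingMSharp_eq_settingPrVolSharpM]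
  exact negLogThetaSlot_le_negLogTheta_settingMSharp D hlog M archPk archSub Ψ act Mmod region n lat sig split qData _ tq htq0 Sq htq1
    (thetaSlotFinite_settingMSharp_tOfIdeleData D hlog r tq M archPk archSub Ψ act Mmod region n lat sig split qData htq0 Sq htq1)

/-- **THE JUNCTION, two-sided, at the summand-route M-level sharp setting of the datum's own Θ-ideles** (any `q`-ideles; `I = volumeInputOf D r`):
for any set `C ⊆ T(I)` of support primes at which `I` is slot-constant,
`−|log(Θ)|_(P) + ↑(SR(I) − Σ_{p∈T(I)∖C} log p) ≤ −|log(Θ)|_(U) ≤ −|log(Θ)|_(P) + ↑(SR(I) + Σ_{p∈T(I)∖C} log p)`.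
[cite: Mochizuki2012, IUTchIII Cor. 3.12 p. 173–174, proof Step (x) p. 181; Thm. 3.11 (i) (Ind1) p. 154] [cite: Mochizuki2012, IUTchIV Thm. 1.10 Step (v)
p. 27–28] [cite: DupuyHilado2025, §4.7, §4.11–4.12] [claim: Mochizuki2012, status: disputed] -/
theorem negLogTheta_two_sided_negLogThetaSlot_settingPrVolSharpM_tOfIdeleData (C : Finset ℕ)
    (hC : C ⊆ (ThetaData.volumeInputOf D r).supportPrimes)
    (hconst : ∀ p ∈ C, ∀ (i : Fin (ThetaData.volumeInputOf D r).X.lstar) (v w : placesOver (fieldOfModuli E) p),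
      (ThetaData.volumeInputOf D r).X.slotValue i v.1 = (ThetaData.volumeInputOf D r).X.slotValue i w.1) :
    (settingPrVolSharpM D hlog (tOfIdeleData D r) tq M archPk archSub Ψ act Mmod region n lat sig split qData htq0 Sq htq1).negLogThetaSlot +
        ((((ThetaData.volumeInputOf D r).X.slotResidue (ThetaData.volumeInputOf D r).supportPrimes -
            ∑ p ∈ (ThetaData.volumeInputOf D r).supportPrimes \ C, Real.log p : ℝ)) : WithTop ℝ) ≤
      (settingPrVolSharpM D hlog (tOfIdeleData D r) tq M archPk archSub Ψ act Mmod region n lat sig split qData htq0 Sq htq1).negLogTheta ∧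
    (settingPrVolSharpM D hlog (tOfIdeleData D r) tq M archPk archSub Ψ act Mmod region n lat sig split qData htq0 Sq htq1).negLogTheta ≤
      (settingPrVolSharpM D hlog (tOfIdeleData D r) tq M archPk archSub Ψ act Mmod region n lat sig split qData htq0 Sq htq1).negLogThetaSlot +
        ((((ThetaData.volumeInputOf D r).X.slotResidue (ThetaData.volumeInputOf D r).supportPrimes +
            ∑ p ∈ (ThetaData.volumeInputOf D r).supportPrimes \ C, Real.log p : ℝ)) : WithTop ℝ) :=
  Cor312.Setting.negLogTheta_two_sided_negLogThetaSlot_of_exact _ _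
    (negLogTheta_settingPrVolSharpM_tOfIdeleData_eq_negLogThetaNonarch D hlog r tq M archPk archSub Ψ act Mmod region n lat sig split qData
      htq0 Sq htq1)
    (negLogThetaSlot_settingPrVolSharpM_tOfIdeleData_eq_negLogThetaPerImageNonarch D hlog r tq M archPk archSub Ψ act Mmod region n lat sig
      split qData htq0 Sq htq1) C hC hconst

/-- **… and at the frames-route setting `settingMSharp`.** [cite: Mochizuki2012, IUTchIII Cor. 3.12 p. 173–174, proof Step (x) p. 181]
[cite: Mochizuki2012, IUTchIV Thm. 1.10 Step (v) p. 27–28] [claim: Mochizuki2012, status: disputed] -/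
theorem negLogTheta_two_sided_negLogThetaSlot_settingMSharp_tOfIdeleData (C : Finset ℕ)
    (hC : C ⊆ (ThetaData.volumeInputOf D r).supportPrimes)
    (hconst : ∀ p ∈ C, ∀ (i : Fin (ThetaData.volumeInputOf D r).X.lstar) (v w : placesOver (fieldOfModuli E) p),
      (ThetaData.volumeInputOf D r).X.slotValue i v.1 = (ThetaData.volumeInputOf D r).X.slotValue i w.1) :
    (settingMSharp D hlog M archPk archSub Ψ act Mmod region n lat sig split qData (tOfIdeleData D r) tq htq0 Sq htq1).negLogThetaSlot +
        ((((ThetaData.volumeInputOf D r).X.slotResidue (ThetaData.volumeInputOf D r).supportPrimes -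
            ∑ p ∈ (ThetaData.volumeInputOf D r).supportPrimes \ C, Real.log p : ℝ)) : WithTop ℝ) ≤
      (settingMSharp D hlog M archPk archSub Ψ act Mmod region n lat sig split qData (tOfIdeleData D r) tq htq0 Sq htq1).negLogTheta ∧
    (settingMSharp D hlog M archPk archSub Ψ act Mmod region n lat sig split qData (tOfIdeleData D r) tq htq0 Sq htq1).negLogTheta ≤
      (settingMSharp D hlog M archPk archSub Ψ act Mmod region n lat sig split qData (tOfIdeleData D r) tq htq0 Sq htq1).negLogThetaSlot +
        ((((ThetaData.volumeInputOf D r).X.slotResidue (ThetaData.volumeInputOf D r).supportPrimes +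
            ∑ p ∈ (ThetaData.volumeInputOf D r).supportPrimes \ C, Real.log p : ℝ)) : WithTop ℝ) :=
  Cor312.Setting.negLogTheta_two_sided_negLogThetaSlot_of_exact _ _
    (negLogTheta_settingMSharp_tOfIdeleData_eq_negLogThetaNonarch D hlog r tq M archPk archSub Ψ act Mmod region n lat sig split qData htq0
      Sq htq1)
    (negLogThetaSlot_settingMSharp_tOfIdeleData_eq_negLogThetaPerImageNonarch D hlog r tq M archPk archSub Ψ act Mmod region n lat sig split
      qData htq0 Sq htq1) C hC hconst

/-- **… with no slot-constancy information** (`C = ∅`, summand route): `|−|log(Θ)|_(U) − −|log(Θ)|_(P) − SR(I)| ≤ Σ_{p∈T(I)} log p`.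
[cite: Mochizuki2012, IUTchIII Cor. 3.12 proof Step (x) p. 181] [cite: Mochizuki2012, IUTchIV Thm. 1.10 Step (v) p. 27–28] [claim: Mochizuki2012, status: disputed] -/
theorem negLogTheta_two_sided_negLogThetaSlot_settingPrVolSharpM_tOfIdeleData' :
    (settingPrVolSharpM D hlog (tOfIdeleData D r) tq M archPk archSub Ψ act Mmod region n lat sig split qData htq0 Sq htq1).negLogThetaSlot +
        ((((ThetaData.volumeInputOf D r).X.slotResidue (ThetaData.volumeInputOf D r).supportPrimes -
            ∑ p ∈ (ThetaData.volumeInputOf D r).supportPrimes, Real.log p : ℝ)) : WithTop ℝ) ≤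
      (settingPrVolSharpM D hlog (tOfIdeleData D r) tq M archPk archSub Ψ act Mmod region n lat sig split qData htq0 Sq htq1).negLogTheta ∧
    (settingPrVolSharpM D hlog (tOfIdeleData D r) tq M archPk archSub Ψ act Mmod region n lat sig split qData htq0 Sq htq1).negLogTheta ≤
      (settingPrVolSharpM D hlog (tOfIdeleData D r) tq M archPk archSub Ψ act Mmod region n lat sig split qData htq0 Sq htq1).negLogThetaSlot +
        ((((ThetaData.volumeInputOf D r).X.slotResidue (ThetaData.volumeInputOf D r).supportPrimes +
            ∑ p ∈ (ThetaData.volumeInputOf D r).supportPrimes, Real.log p : ℝ)) : WithTop ℝ) :=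
  Cor312.Setting.negLogTheta_two_sided_negLogThetaSlot_of_exact' _ _
    (negLogTheta_settingPrVolSharpM_tOfIdeleData_eq_negLogThetaNonarch D hlog r tq M archPk archSub Ψ act Mmod region n lat sig split qData
      htq0 Sq htq1)
    (negLogThetaSlot_settingPrVolSharpM_tOfIdeleData_eq_negLogThetaPerImageNonarch D hlog r tq M archPk archSub Ψ act Mmod region n lat sig
      split qData htq0 Sq htq1)

/-- **COINCIDENCE AT SLOT-CONSTANT DATA** (summand route): if `I = volumeInputOf D r` is slot-constant at every support prime (every `d_mod = 1` datum;
one place of `F_mod` over each `p ∈ T(I)`), then `−|log(Θ)|_(P) = −|log(Θ)|_(U)` at the M-level sharp setting of its own Θ-ideles — reading (P) costs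
NOTHING more than print's reading (U) there. [cite: Mochizuki2012, IUTchIII Cor. 3.12 proof Step (x) p. 181] [cite: Mochizuki2012, IUTchIV Thm. 1.10
Step (v) p. 28] [cite: DupuyHilado2025, §4.7, §4.12] [claim: Mochizuki2012, status: disputed] -/
theorem negLogThetaSlot_eq_negLogTheta_settingPrVolSharpM_tOfIdeleData_of_slotConstant
    (hconst : ∀ p ∈ (ThetaData.volumeInputOf D r).supportPrimes, ∀ (i : Fin (ThetaData.volumeInputOf D r).X.lstar)
      (v w : placesOver (fieldOfModuli E) p),
      (ThetaData.volumeInputOf D r).X.slotValue i v.1 = (ThetaData.volumeInputOf D r).X.slotValue i w.1) :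
    (settingPrVolSharpM D hlog (tOfIdeleData D r) tq M archPk archSub Ψ act Mmod region n lat sig split qData htq0 Sq htq1).negLogThetaSlot =
      (settingPrVolSharpM D hlog (tOfIdeleData D r) tq M archPk archSub Ψ act Mmod region n lat sig split qData htq0 Sq htq1).negLogTheta :=
  Cor312.Setting.negLogThetaSlot_eq_negLogTheta_of_exact_of_slotConstant _ _
    (negLogTheta_settingPrVolSharpM_tOfIdeleData_eq_negLogThetaNonarch D hlog r tq M archPk archSub Ψ act Mmod region n lat sig split qData
      htq0 Sq htq1)
    (negLogThetaSlot_settingPrVolSharpM_tOfIdeleData_eq_negLogThetaPerImageNonarch D hlog r tq M archPk archSub Ψ act Mmod region n lat sig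
      split qData htq0 Sq htq1) hconst

/-- **… and at the frames-route setting `settingMSharp`.** [cite: Mochizuki2012, IUTchIV Thm. 1.10 Step (v) p. 28] [claim: Mochizuki2012, status: disputed] -/
theorem negLogThetaSlot_eq_negLogTheta_settingMSharp_tOfIdeleData_of_slotConstant
    (hconst : ∀ p ∈ (ThetaData.volumeInputOf D r).supportPrimes, ∀ (i : Fin (ThetaData.volumeInputOf D r).X.lstar)
      (v w : placesOver (fieldOfModuli E) p),
      (ThetaData.volumeInputOf D r).X.slotValue i v.1 = (ThetaData.volumeInputOf D r).X.slotValue i w.1) :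
    (settingMSharp D hlog M archPk archSub Ψ act Mmod region n lat sig split qData (tOfIdeleData D r) tq htq0 Sq htq1).negLogThetaSlot =
      (settingMSharp D hlog M archPk archSub Ψ act Mmod region n lat sig split qData (tOfIdeleData D r) tq htq0 Sq htq1).negLogTheta := by
  rw [negLogThetaSlot_settingMSharp_eq_settingPrVolSharpM, negLogTheta_settingMSharp_eq_settingPrVolSharpM]
  exact negLogThetaSlot_eq_negLogTheta_settingPrVolSharpM_tOfIdeleData_of_slotConstant D hlog r tq M archPk archSub Ψ act Mmod region n lat
    sig split qData htq0 Sq htq1 hconst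

/-- **`SlotStatement ↔ Statement` AT SLOT-CONSTANT DATA** (summand route): the M-line reading-(P) and reading-(U) conclusions of [IUTchIII] Cor. 3.12
are THE SAME CLAIM there. [cite: Mochizuki2012, IUTchIII Cor. 3.12 p. 174 l. 16–18, proof Step (x) p. 181] [claim: Mochizuki2012, status: disputed] -/
theorem slotStatement_iff_statement_settingPrVolSharpM_tOfIdeleData_of_slotConstant
    (hconst : ∀ p ∈ (ThetaData.volumeInputOf D r).supportPrimes, ∀ (i : Fin (ThetaData.volumeInputOf D r).X.lstar)
      (v w : placesOver (fieldOfModuli E) p),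
      (ThetaData.volumeInputOf D r).X.slotValue i v.1 = (ThetaData.volumeInputOf D r).X.slotValue i w.1) :
    (settingPrVolSharpM D hlog (tOfIdeleData D r) tq M archPk archSub Ψ act Mmod region n lat sig split qData htq0 Sq htq1).SlotStatement ↔
      (settingPrVolSharpM D hlog (tOfIdeleData D r) tq M archPk archSub Ψ act Mmod region n lat sig split qData htq0 Sq htq1).Statement :=
  Cor312.Setting.slotStatement_iff_statement_of_negLogThetaSlot_eq _
    (negLogThetaSlot_eq_negLogTheta_settingPrVolSharpM_tOfIdeleData_of_slotConstant D hlog r tq M archPk archSub Ψ act Mmod region n lat sig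
      split qData htq0 Sq htq1 hconst)

/-- **… and at the frames-route setting `settingMSharp`.** [cite: Mochizuki2012, IUTchIII Cor. 3.12 p. 174 l. 16–18] [claim: Mochizuki2012, status: disputed] -/
theorem slotStatement_iff_statement_settingMSharp_tOfIdeleData_of_slotConstant
    (hconst : ∀ p ∈ (ThetaData.volumeInputOf D r).supportPrimes, ∀ (i : Fin (ThetaData.volumeInputOf D r).X.lstar)
      (v w : placesOver (fieldOfModuli E) p),
      (ThetaData.volumeInputOf D r).X.slotValue i v.1 = (ThetaData.volumeInputOf D r).X.slotValue i w.1) :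
    (settingMSharp D hlog M archPk archSub Ψ act Mmod region n lat sig split qData (tOfIdeleData D r) tq htq0 Sq htq1).SlotStatement ↔
      (settingMSharp D hlog M archPk archSub Ψ act Mmod region n lat sig split qData (tOfIdeleData D r) tq htq0 Sq htq1).Statement :=
  Cor312.Setting.slotStatement_iff_statement_of_negLogThetaSlot_eq _
    (negLogThetaSlot_eq_negLogTheta_settingMSharp_tOfIdeleData_of_slotConstant D hlog r tq M archPk archSub Ψ act Mmod region n lat sig split
      qData htq0 Sq htq1 hconst)

/-- **… in particular for `F_mod` of degree one** (`d_mod = 1`; summand route): the two typed conclusions coincide — the (Ind1) slot residue is void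
there. [cite: Mochizuki2012, IUTchIII Cor. 3.12 p. 174 l. 16–18] [claim: Mochizuki2012, status: disputed] -/
theorem slotStatement_iff_statement_settingPrVolSharpM_tOfIdeleData_of_finrank_eq_one (hF : Module.finrank ℚ (fieldOfModuli E) = 1) :
    (settingPrVolSharpM D hlog (tOfIdeleData D r) tq M archPk archSub Ψ act Mmod region n lat sig split qData htq0 Sq htq1).SlotStatement ↔
      (settingPrVolSharpM D hlog (tOfIdeleData D r) tq M archPk archSub Ψ act Mmod region n lat sig split qData htq0 Sq htq1).Statement :=
  Cor312.Setting.slotStatement_iff_statement_of_exact_of_finrank_eq_one _ _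
    (negLogTheta_settingPrVolSharpM_tOfIdeleData_eq_negLogThetaNonarch D hlog r tq M archPk archSub Ψ act Mmod region n lat sig split qData
      htq0 Sq htq1)
    (negLogThetaSlot_settingPrVolSharpM_tOfIdeleData_eq_negLogThetaPerImageNonarch D hlog r tq M archPk archSub Ψ act Mmod region n lat sig
      split qData htq0 Sq htq1) hF

end Summit.ABC.IUTFork.Thm311.Real

/-! ## §6. Own Θ- AND `q`-ideles (the M books' setting shape): `SlotStatement ↔ I.Cor312PerImageNonarchOf`, and how much stronger (P) is -/

namespace Summit.ABC.IUTFork.Thm311.Real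

open Cor312 Cor312Vol Cor312Prov Literature.IUT.LogThetaLattice Literature.IUT.LogVolume Literature.IUT.HodgeTheaters
  Literature.NumberTheory.NumberFields

variable {F K Fbar : Type} [Field F] [NumberField F] [Field K] [NumberField K] [Algebra F K]
  [Field Fbar] [Algebra F Fbar] [Algebra K Fbar] {E : WeierstrassCurve F} [E.IsElliptic] {l : ℕ}
  {Pb : BadPlacePredicates K} (D : InitialThetaData F K Fbar E l Pb) {logvK : PadicLogsVal K}
  (hlog : LogvAnalyticVal logvK) {I : ThetaVolumeInput (fieldOfModuli E) K} (hI : ThetaData.IsVolumeInputOf D I)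
  (M : Type) [Field M] [NumberField M]
  (archPk : ∀ (j : (thetaIndexOfInitial D).Label) (vQ : (thetaIndexOfInitial D).VQ),
    Set ((logShellsOfInitialDH D logvK).Packet j vQ))
  (archSub : ∀ (j : (thetaIndexOfInitial D).Label) (v : (thetaIndexOfInitial D).V),
    Set ((logShellsOfInitialDH D logvK).Packet j ((thetaIndexOfInitial D).over v)))
  (Ψ : ℤ → ∀ v : (thetaIndexOfInitial D).V, v ∈ (thetaIndexOfInitial D).Vbad →
    Set ((logShellsOfInitialDH D logvK).StarPacket v))
  (act : ℤ → ∀ v : (thetaIndexOfInitial D).V, v ∈ (thetaIndexOfInitial D).Vbad →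
    (logShellsOfInitialDH D logvK).StarPacket v → Module.End ℚ ((logShellsOfInitialDH D logvK).StarPacket v))
  (Mmod : ℤ → ∀ j : (thetaIndexOfInitial D).LabelStar, Set ((logShellsOfInitialDH D logvK).GlobalPacket j.1))
  (region : ℤ → ∀ j : (thetaIndexOfInitial D).LabelStar, FinDivisor M → ∀ vQ : (thetaIndexOfInitial D).VQ,
    Set ((logShellsOfInitialDH D logvK).Packet j.1 vQ))
  (n : ℤ) {HT : Type} {LogLink : HT → HT → Type} {IsFull : ∀ {s t : HT}, LogLink s t → Prop}
  (lat : LGPGaussianLogThetaLattice LogLink IsFull)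
  {Frd : Type} {IsoF : Frd → Frd → Type} {Ob : Frd → Type} {realify : Frd → Frd} {Strip : Type}
  {IsoS : Strip → Strip → Type}
  {Mv : ∀ v : (thetaIndexOfInitial D).V, v ∈ (thetaIndexOfInitial D).Vbad → Type} [∀ v h, Monoid (Mv v h)]
  (sig : GlobalLGPFrobenioidSignature (thetaIndexOfInitial D).lstar (thetaIndexOfInitial D).V
    (· ∈ (thetaIndexOfInitial D).Vbad) Frd IsoF Ob realify Strip IsoS Mv)
  (split : SplittingMonoids Mv) {ObΔ : Type}
  {N : ∀ v : (thetaIndexOfInitial D).V, v ∈ (thetaIndexOfInitial D).Vbad → Type} [∀ v h, Monoid (N v h)]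
  (qData : QPilotData ObΔ N)
  (Sq : Finset (FinitePlace ℚ))
  (htq1 : ∀ (u : FinitePlace ℚ) (x : (thetaIndexOfInitial D).Fibre (Val.non u)), u ∉ Sq →
    ‖tqM D (ratChar u) u (natCast_ratChar_mem u) (ideleDataOf D hI) x‖ = 1)

/-- **EXACT READOUT IN READING (P) on the summand route: `SlotStatement(settingPrVolSharpM … own ideles of I …) ↔ I.Cor312PerImageNonarchOf`** for every
volume input `I` of `D` and ANY context binders — the M-line `hstPBad` body (abc-iut-C-cert-1 p468614, the M books' VERBATIM setting shape) IS, per datum,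
«Dupuy–Hilado's (1.1) PER IMAGE, nonarchimedean form» for the genuine input. `q`-side: abc-iut-w5-d244 `negLogQ_settingPrVolSharpM_ideleDataOf_eq_negAbsLogQ`;
Θ-side: abc-iut-C-cert-2's READ p469199. The (P) twin of abc-iut-s2-p7's `statement_settingPrVolSharpM_genuine_iff_cor312NonarchOf`.
[cite: Mochizuki2012, IUTchIII Cor. 3.12 p. 174 l. 4–18, proof Step (x) p. 181] [cite: DupuyHilado2025, §1 (1.1), §4.12] [claim: Mochizuki2012, status: disputed] -/
theorem slotStatement_settingPrVolSharpM_genuine_iff_cor312PerImageNonarchOf :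
    (settingPrVolSharpM D hlog (tOfIdeleData D (ideleDataOf D hI))
        (fun u x => tqM D (ratChar u) u (natCast_ratChar_mem u) (ideleDataOf D hI) x) M archPk archSub Ψ act Mmod region n lat sig split
        qData (fun u x => tqM_ne_zero D (ratChar u) u (natCast_ratChar_mem u) (ideleDataOf D hI) x) Sq htq1).SlotStatement ↔
      I.Cor312PerImageNonarchOf :=
  Cor312.Setting.slotStatement_iff_cor312PerImageNonarchOf_of_exact _ I
    (negLogQ_settingPrVolSharpM_ideleDataOf_eq_negAbsLogQ D hlog M archPk archSub Ψ act Mmod region n lat sig split qData _ Sq hI htq1)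
    (negLogThetaSlot_settingPrVolSharpM_eq_negLogThetaPerImageNonarch_of_isVolumeInputOf D hlog _ M archPk archSub Ψ act Mmod region n lat
      sig split qData _ Sq htq1 hI)

/-- **… and on the frames route: `SlotStatement(settingMSharp … own ideles of I …) ↔ I.Cor312PerImageNonarchOf`** (part (iii-a)'s
`slotStatement_settingMSharp_iff_settingPrVolSharpM`). [cite: Mochizuki2012, IUTchIII Cor. 3.12 p. 174 l. 4–18] [cite: DupuyHilado2025, §1 (1.1)]
[claim: Mochizuki2012, status: disputed] -/
theorem slotStatement_settingMSharp_genuine_iff_cor312PerImageNonarchOf :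
    (settingMSharp D hlog M archPk archSub Ψ act Mmod region n lat sig split qData (tOfIdeleData D (ideleDataOf D hI))
        (fun u x => tqM D (ratChar u) u (natCast_ratChar_mem u) (ideleDataOf D hI) x)
        (fun u x => tqM_ne_zero D (ratChar u) u (natCast_ratChar_mem u) (ideleDataOf D hI) x) Sq htq1).SlotStatement ↔
      I.Cor312PerImageNonarchOf := by
  rw [slotStatement_settingMSharp_iff_settingPrVolSharpM]
  exact slotStatement_settingPrVolSharpM_genuine_iff_cor312PerImageNonarchOf D hlog hI M archPk archSub Ψ act Mmod region n lat sig split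
    qData Sq htq1

/-- **Per datum on the M line: the reading-(P) conclusion implies Dupuy–Hilado's (1.1) in BOTH forms** (`I.Cor312PerImageNonarchOf` and — the (P) number
being the smaller — `I.Cor312NonarchOf`, i.e. the M-line `hst` body, abc-iut-s2-p7 `statement_settingMSharp_genuine_iff_cor312NonarchOf`).
[cite: Mochizuki2012, IUTchIII Cor. 3.12 p. 174] [cite: DupuyHilado2025, §1 (1.1)] [claim: Mochizuki2012, status: disputed] -/
theorem GenuineM.cor312NonarchOf_of_slotStatement
    (hst : (settingMSharp D hlog M archPk archSub Ψ act Mmod region n lat sig split qData (tOfIdeleData D (ideleDataOf D hI))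
        (fun u x => tqM D (ratChar u) u (natCast_ratChar_mem u) (ideleDataOf D hI) x)
        (fun u x => tqM_ne_zero D (ratChar u) u (natCast_ratChar_mem u) (ideleDataOf D hI) x) Sq htq1).SlotStatement) :
    I.Cor312PerImageNonarchOf ∧ I.Cor312NonarchOf := by
  have h := (slotStatement_settingMSharp_genuine_iff_cor312PerImageNonarchOf D hlog hI M archPk archSub Ψ act Mmod region n lat sig split qData
    Sq htq1).mp hst
  exact ⟨h, DHData.cor312NonarchOf_of_cor312PerImageNonarchOf I h⟩

/-- **HOW MUCH STRONGER (P) IS on the M line, per datum**: the reading-(U) conclusion (`hst`'s body ⟺ `I.Cor312NonarchOf`, abc-iut-s2-p7) yields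
Dupuy–Hilado's (1.1) PER IMAGE weakened by EXACTLY the (Ind1) slot residue of the pilot data plus the rounding sum:
`−|log(q)| ≤ −|log(Θ)|_(P)^nonarch(I) + (SR(I) + Σ_{p∈T(I)} log p)`. [cite: Mochizuki2012, IUTchIII Cor. 3.12 p. 174, proof Step (x) p. 181]
[cite: Mochizuki2012, IUTchIV Thm. 1.10 Step (v) p. 27–28] [cite: DupuyHilado2025, §1 (1.1), §4.7, §4.12] [claim: Mochizuki2012, status: disputed] -/
theorem GenuineM.cor312PerImageNonarch_add_slotResidue_of_statement
    (hst : (settingMSharp D hlog M archPk archSub Ψ act Mmod region n lat sig split qData (tOfIdeleData D (ideleDataOf D hI))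
        (fun u x => tqM D (ratChar u) u (natCast_ratChar_mem u) (ideleDataOf D hI) x)
        (fun u x => tqM_ne_zero D (ratChar u) u (natCast_ratChar_mem u) (ideleDataOf D hI) x) Sq htq1).Statement) :
    I.negAbsLogQ ≤ I.negLogThetaPerImageNonarch + (I.X.slotResidue I.supportPrimes + ∑ p ∈ I.supportPrimes, Real.log p) := by
  have hU : I.Cor312NonarchOf := (statement_settingMSharp_genuine_iff_cor312NonarchOf D hlog hI M archPk archSub Ψ act Mmod region n lat sig
    split qData Sq htq1).mp hst
  unfold ThetaVolumeInput.Cor312NonarchOf at hU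
  linarith [I.negLogThetaNonarch_le_perImage_add_slotResidue]

/-! ## §7. The M line and the `K` line carry THE SAME reading-(P) hypothesis per datum -/

/-- **M ↔ K AGREEMENT of the typed [IUTchIII] Cor. 3.12 IN READING (P)**: for every volume input `I` of the initial Θ-data `D`, the typed `SlotStatement` at
abc-iut-w5-d166's M-level sharp setting of `I`'s OWN ideles (ANY M-side context binders) holds IFF the typed `SlotStatement` at abc-iut-c312-7's `K`-level
sharp setting `settingPrVolSharp (pilotDataOfK D K) …` holds at ANY realising Θ-idele `t` and realising `q`-idele `tq` (ANY `K`-side context binders): both are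
Dupuy–Hilado's (1.1) PER IMAGE for `I` (§6 and abc-iut-s2-p2's `slotStatement_settingPrVolSharp_pilotDataOfK_iff_cor312PerImageNonarchOf`, p464613). So the
[hstPBad] hypotheses of abc-iut-C-cert-1's M γ certificates (p468614) and abc-iut-C-cert-2's `K` γ certificates (p458998/p462946) are, per datum, ONE
proposition — the (P) twin of abc-iut-s2-p7's `statement_settingMSharp_genuine_iff_statement_settingPrVolSharp_pilotDataOfK`.
[cite: Mochizuki2012, IUTchIII Cor. 3.12 p. 173–174, proof Step (x) p. 181] [cite: DupuyHilado2025, §1 (1.1), §4.12] [claim: Mochizuki2012, status: disputed] -/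
theorem slotStatement_settingMSharp_genuine_iff_slotStatement_settingPrVolSharp_pilotDataOfK
    (MK : Type) [Field MK] [NumberField MK]
    (archPkK : ∀ (j : (thetaIndex (pilotDataOfK D K)).Label) (vQ : (thetaIndex (pilotDataOfK D K)).VQ),
      Set ((logShellsDH (pilotDataOfK D K) (analyticLogv K)).Packet j vQ))
    (archSubK : ∀ (j : (thetaIndex (pilotDataOfK D K)).Label) (v : (thetaIndex (pilotDataOfK D K)).V),
      Set ((logShellsDH (pilotDataOfK D K) (analyticLogv K)).Packet j ((thetaIndex (pilotDataOfK D K)).over v)))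
    (ΨK : ℤ → ∀ v : (thetaIndex (pilotDataOfK D K)).V, v ∈ (thetaIndex (pilotDataOfK D K)).Vbad →
      Set ((logShellsDH (pilotDataOfK D K) (analyticLogv K)).StarPacket v))
    (actK : ℤ → ∀ v : (thetaIndex (pilotDataOfK D K)).V, v ∈ (thetaIndex (pilotDataOfK D K)).Vbad →
      (logShellsDH (pilotDataOfK D K) (analyticLogv K)).StarPacket v →
        Module.End ℚ ((logShellsDH (pilotDataOfK D K) (analyticLogv K)).StarPacket v))
    (MmodK : ℤ → ∀ j : (thetaIndex (pilotDataOfK D K)).LabelStar,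
      Set ((logShellsDH (pilotDataOfK D K) (analyticLogv K)).GlobalPacket j.1))
    (regionK : ℤ → ∀ j : (thetaIndex (pilotDataOfK D K)).LabelStar, FinDivisor MK → ∀ vQ : (thetaIndex (pilotDataOfK D K)).VQ,
      Set ((logShellsDH (pilotDataOfK D K) (analyticLogv K)).Packet j.1 vQ))
    (nK : ℤ) {HTK : Type} {LogLinkK : HTK → HTK → Type} {IsFullK : ∀ {s t : HTK}, LogLinkK s t → Prop}
    (latK : LGPGaussianLogThetaLattice LogLinkK IsFullK)
    {FrdK : Type} {IsoFK : FrdK → FrdK → Type} {ObK : FrdK → Type} {realifyK : FrdK → FrdK} {StripK : Type}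
    {IsoSK : StripK → StripK → Type}
    {MvK : ∀ v : (thetaIndex (pilotDataOfK D K)).V, v ∈ (thetaIndex (pilotDataOfK D K)).Vbad → Type} [∀ v h, Monoid (MvK v h)]
    (sigK : GlobalLGPFrobenioidSignature (thetaIndex (pilotDataOfK D K)).lstar (thetaIndex (pilotDataOfK D K)).V
      (· ∈ (thetaIndex (pilotDataOfK D K)).Vbad) FrdK IsoFK ObK realifyK StripK IsoSK MvK)
    (splitK : SplittingMonoids MvK) {ObΔK : Type}
    {NK : ∀ v : (thetaIndex (pilotDataOfK D K)).V, v ∈ (thetaIndex (pilotDataOfK D K)).Vbad → Type} [∀ v h, Monoid (NK v h)]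
    (qDataK : QPilotData ObΔK NK)
    (tq : ∀ (pp : Nat.Primes) (x : (thetaIndex (pilotDataOfK D K)).Fibre (.inr pp)),
      haveI : Fact (pp : ℕ).Prime := ⟨pp.2⟩; kOf (pilotDataOfK D K) pp.1 x)
    (t : ∀ (pp : Nat.Primes) (_ : Fin (pilotDataOfK D K).lstar) (x : (thetaIndex (pilotDataOfK D K)).Fibre (.inr pp)),
      haveI : Fact (pp : ℕ).Prime := ⟨pp.2⟩; kOf (pilotDataOfK D K) pp.1 x)
    (htq0 : ∀ pp x, tq pp x ≠ 0)
    (htq1K : ∀ (pp : Nat.Primes) (x : (thetaIndex (pilotDataOfK D K)).Fibre (.inr pp)),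
      haveI : Fact (pp : ℕ).Prime := ⟨pp.2⟩; placeOf (pilotDataOfK D K) pp.1 x ∉ (pilotDataOfK D K).S → ‖tq pp x‖ = 1)
    (ht0 : ∀ pp i x, t pp i x ≠ 0)
    (hT : ∀ (pp : Nat.Primes) (i : Fin (pilotDataOfK D K).lstar) (x : (thetaIndex (pilotDataOfK D K)).Fibre (.inr pp)),
      haveI : Fact (pp : ℕ).Prime := ⟨pp.2⟩
      Real.log ‖t pp i x‖ = -((pilotDataOfK D K).thetaPilot i (placeOf (pilotDataOfK D K) pp.1 x)) *
        logNorm K (placeOf (pilotDataOfK D K) pp.1 x) / localDegree K (placeOf (pilotDataOfK D K) pp.1 x))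
    (htq : ∀ (pp : Nat.Primes) (x : (thetaIndex (pilotDataOfK D K)).Fibre (.inr pp)),
      haveI : Fact (pp : ℕ).Prime := ⟨pp.2⟩
      Real.log ‖tq pp x‖ = -((pilotDataOfK D K).qPilot (placeOf (pilotDataOfK D K) pp.1 x)) *
        logNorm K (placeOf (pilotDataOfK D K) pp.1 x) / localDegree K (placeOf (pilotDataOfK D K) pp.1 x)) :
    (settingMSharp D hlog M archPk archSub Ψ act Mmod region n lat sig split qData (tOfIdeleData D (ideleDataOf D hI))
        (fun u x => tqM D (ratChar u) u (natCast_ratChar_mem u) (ideleDataOf D hI) x)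
        (fun u x => tqM_ne_zero D (ratChar u) u (natCast_ratChar_mem u) (ideleDataOf D hI) x) Sq htq1).SlotStatement ↔
      (settingPrVolSharp (pilotDataOfK D K) (logvAnalytic_analyticLogv (F := K)) MK archPkK archSubK ΨK actK MmodK regionK nK latK sigK
        splitK qDataK tq t htq0 htq1K).SlotStatement := by
  rw [slotStatement_settingMSharp_genuine_iff_cor312PerImageNonarchOf D hlog hI M archPk archSub Ψ act Mmod region n lat sig split qData Sq htq1,
    slotStatement_settingPrVolSharp_pilotDataOfK_iff_cor312PerImageNonarchOf D MK archPkK archSubK ΨK actK MmodK regionK nK latK sigK splitK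
      qDataK tq t htq0 htq1K ht0 hT htq hI]

end Summit.ABC.IUTFork.Thm311.Real

end
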